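import Summits.QuantumFields.BalabanUV.Beta.D1BFx.GhostLegWard
import Summits.QuantumFields.BalabanUV.Beta.TameKernelCalculus
import Literature.MathematicalPhysics.QuantumFieldTheory.Balaban1983to89.Beta.HessKerSchurResolvent

/-!
# `BalabanUV.Beta.D1BFx.FrozenAveragingWard` — road «BF-x» for binder row D1, slot (K), junction (J3), ROUTE M of TB5-1′ ((C3) by the Ward route),
# FILE B: **THE FROZEN-AVERAGING WARD IDENTITY** — for the ghost leg `Ggh n a = (n²·D*D + a·Q′*Q′)⁻¹`, ANY localised vertex `V` and any localised gauge
# function `f`, `bubble Ggh V [O, f̂] = tadpole Ggh [V, f̂]` (`O = Oker n a`, `f̂` = multiplication by `f`); HENCE the gauge slots of the `D*D`-only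
# Hessian see ONLY the frozen averaging part `P_a = a·n⁻⁴·1[same block]` of `O`:
# `½·tadpole Ggh [V, f̂] − ½·bubble Ggh V [n²(−Δ), f̂] = ½·bubble Ggh V [P_a, f̂]`,
# `½·tadpole Ggh [[n²(−Δ), f̂], f̂′] − ½·bubble Ggh [n²(−Δ), f̂] [n²(−Δ), f̂′] = ½·tadpole Ggh [[P_a, f̂′], f̂] − ½·bubble Ggh [P_a, f̂] [P_a, f̂′]`

WHY (journal [D1LEAF04-G22-ONLINE]): PART 16's (C3) rows concern the four `Q′`-words `BR` at the road's DRESSED weights `colH G₀ = colH K₀ − grad χ`; by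
F6∕F7 `BR[colH G₀] = BR[colH K₀] + (DD[colH K₀] − DD[colH G₀])`, `DD[w]` the `D*D`-only word, and the difference is a sum of GAUGE slots of the `D*D`-only
Hessian.  The `D*D` jets are covariant: their pure-gauge stencil is `[n²(−Δ), f̂] = [O, f̂] − [P_a, f̂]`, and the `[O, f̂]` part telescopes against the
leg (`Ggh ∘ O = 𝟙 = O ∘ Ggh`) exactly as in `KernelWard.ward_hess` — THIS FILE is that telescoping with `f̂` in place of the site generator `genX u`.
What survives is a `Q′*Q′`-word: the gauge variation of the FROZEN-averaging ghost loop.  The commutator is written POINTWISE,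
`[K, f̂] (x,z) = (f z − f x)·K x z` — NO definition.  CONTENT (all [folklore]; fibre `Unit`, `n ≥ 1`, `0 < a`): §1 letters (`spr_Oker`, `comp_Ggh_Oker`,
`comp_Oker_Ggh`, `comp_mulK_right∕left`, `comm_mulK_eq`, `loc_commK_*`, `bubble_symm`, `bubble_sub_*`); §2 **`bubble_Ggh_comm_Oker`** (Ω);
§3 **`hess_slot_grad`**, **`hess_grad_slot`**, **`hess_grad_grad`**.  NOT HERE: the summation-by-parts identities for the packed `D*D` jets at a gradient
weight (FILE C), the block gauge function's envelope (FILE A), the rows (FILE D).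

HONEST DEPENDENCY (cell records, verbatim): «continuum YM on T⁴ ⇐ BetaPertH ∧ nine spine estimates (0/9 proved); BetaPertH ⇐ (D1) ∧ (D4) ∧
CAP+tail; G-an2-4 gates asym, D1 and NE2/3/4.»  HONEST FRAMING (cell contract, verbatim): «discharging `BetaPertH` makes Bałaban's UV stability
UNCONDITIONAL — a real constructive-QFT result; it is NOT the continuum limit and NOT the Clay problem.»  THIS MODULE DISCHARGES NOTHING of (K),
of D1 or of the wall: [folklore] trace algebra over OUR ghost leg and operator (an2's `TameKernelCalculus` BY NAME).  No definition, no `def … : Prop`,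
nothing cited, 0 sorry.  0 root-level binders of row D1 discharged; (J3) DISPLAYED; (K) NOT closed; NOT D1, NOT `BetaPertH`, NOT continuum, NOT Clay.
ABSOLUTE RULE (cell charter, verbatim): «No internally-minted statement may enter as a cited fact. Every hypothesis is either kernel-proved in this
package or a verbatim quotation of a PUBLISHED theorem with page reference. The manuscript(s) under audit are NOT citable for their own disputed
steps — they are the thing under adjudication; programme-internal (2001/route/tribunal) claims are never citable.»
Unit `b2b-balaban-beta-d1-formalise-leaf-04` (gen 22), D1 formalisation swarm leaf prover 04, road «BF-x»; ROUTE M (C3), FILE B (journal [D1LEAF04-G22-*]).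
-/

noncomputable section

namespace Summit.QuantumFields.BalabanUV.Beta.D1BFx.FrozenAveragingWard

open Finset
open scoped BigOperators
open Literature.MathematicalPhysics.QuantumFieldTheory.Balaban1983to89
open Literature.MathematicalPhysics.QuantumFieldTheory.Balaban1983to89.Beta
open B12Sec2to5 (l1 l1_nonneg)
open B6QGQLower276 (e blk lapKer sameBlk AX)
open ExpKernelCalculus (Site MKer Decays BiLoc comp tr bubble tadpole l1_sub_triangle l1_sub_symm)
open HessKerSchurResolvent (idK idK_apply comp_idK_left comp_idK_right)
open Summit.QuantumFields.BalabanUV.Beta.TameKernelCalculus (Tame Spr Loc Spr.tame Loc.tame Spr.comp_loc Loc.comp Loc.comp_spr Loc.sub Loc.neg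
  comp_assoc_tame tr_comp_comm_loc comp_sub_right_tame comp_sub_left_tame tr_sub_loc tadpole_add bubble_add_left bubble_add_right comp_neg_right)
open Summit.QuantumFields.BalabanUV.Beta.D1BFx.GhostLeg (Ggh spr_Ggh tsum_Ggh_mul_AX tsum_AX_mul_Ggh)
open Summit.QuantumFields.BalabanUV.Beta.D1BFx.GhostStencil (l1_sub_le_of_blk_eq)
open Summit.QuantumFields.BalabanUV.Beta.D1BFx.GhostStencilWard (comp_unit_apply)
open Summit.QuantumFields.BalabanUV.Beta.D1BFx.GhostStencilDivergence (Oker Oker_apply)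
open Summit.QuantumFields.BalabanUV.Beta.D1BFx.GhostLegWard (Oker_eq_AX)

variable (n : ℕ) [NeZero n] (a : ℝ)

/-! ## §1 Letters -/

/-- [folklore] A nonzero Laplacian entry joins `ℓ¹`-neighbours: `lapKer x z ≠ 0 → |x − z|₁ ≤ 1`. -/
theorem l1_le_one_of_lapKer_ne_zero {x z : Site 4} (hl : lapKer (d := 4) x z ≠ 0) : l1 (x - z) ≤ 1 := by
  unfold lapKer at hl
  obtain ⟨μ, -, hμ⟩ := Finset.exists_ne_zero_of_sum_ne_zero hl
  unfold B6QGQLower276.lapDir at hμ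
  by_cases h0 : z = x
  · rw [h0, sub_self]; simp [l1]
  · rw [if_neg h0] at hμ
    by_cases hp : z = x + e μ
    · rw [l1_sub_symm, hp, add_sub_cancel_left]
      exact (GhostStencil.l1_unitVec (κ' := μ)).le
    · rw [if_neg hp] at hμ
      by_cases hm : z = x - e μ
      · rw [hm, sub_sub_cancel]
        exact (GhostStencil.l1_unitVec (κ' := μ)).le
      · rw [if_neg hm] at hμ; norm_num at hμ

/-- [folklore] `|lapKer x z| ≤ 8`. -/
theorem abs_lapKer_le_eight (x z : Site 4) : |lapKer (d := 4) x z| ≤ 8 := by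
  unfold lapKer
  calc |∑ μ : Fin 4, B6QGQLower276.lapDir μ x z| ≤ ∑ μ : Fin 4, |B6QGQLower276.lapDir μ x z| := Finset.abs_sum_le_sum_abs _ _
    _ ≤ ∑ _μ : Fin 4, (2 : ℝ) := Finset.sum_le_sum fun μ _ => by
        unfold B6QGQLower276.lapDir
        split_ifs <;> norm_num
    _ = 8 := by norm_num

/-- [folklore] An entry of the ghost operator vanishes unless the two sites are `ℓ¹`-close: `Oker n a x z ≠ 0 → |x − z|₁ ≤ 4n`
(Laplacian part: neighbours; block part: one block). -/
theorem l1_le_of_Oker_ne_zero {x z : Site 4} (h : Oker n a x z () () ≠ 0) : l1 (x - z) ≤ 4 * (n : ℝ) := by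
  rw [Oker_apply] at h
  by_cases hb : blk (n - 1) x = blk (n - 1) z
  · exact l1_sub_le_of_blk_eq n hb
  · have hs : sameBlk (n - 1) x z = 0 := by unfold sameBlk; rw [if_neg hb]
    rw [hs, mul_zero, add_zero] at h
    have h1 := l1_le_one_of_lapKer_ne_zero (fun h0 => h (by rw [h0, mul_zero]))
    have hn1 : (1 : ℝ) ≤ (n : ℝ) := by exact_mod_cast NeZero.one_le
    linarith

/-- [folklore] The ghost operator is bounded entrywise: `|Oker n a x z| ≤ 8·n² + |a|·n⁻⁴`. -/
theorem abs_Oker_le (x z : Site 4) : |Oker n a x z () ()| ≤ 8 * (n : ℝ) ^ 2 + |a| / (n : ℝ) ^ 4 := by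
  rw [Oker_apply]
  have hL := abs_lapKer_le_eight x z
  have hS : |sameBlk (n - 1) x z| ≤ 1 := by unfold sameBlk; split_ifs <;> norm_num
  calc |(n : ℝ) ^ 2 * lapKer x z + a / (n : ℝ) ^ 4 * sameBlk (n - 1) x z|
      ≤ |(n : ℝ) ^ 2 * lapKer x z| + |a / (n : ℝ) ^ 4 * sameBlk (n - 1) x z| := abs_add_le _ _
    _ ≤ (n : ℝ) ^ 2 * 8 + |a| / (n : ℝ) ^ 4 * 1 := by
        rw [abs_mul, abs_mul, abs_of_nonneg (by positivity : (0:ℝ) ≤ (n : ℝ) ^ 2), abs_div,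
          abs_of_nonneg (by positivity : (0:ℝ) ≤ (n : ℝ) ^ 4)]
        exact add_le_add (mul_le_mul_of_nonneg_left hL (by positivity)) (mul_le_mul_of_nonneg_left hS (by positivity))
    _ = _ := by ring

/-- [folklore] **THE GHOST OPERATOR IS SPREAD** (finite range `4n`): `Decays (Oker n a) ((8n² + |a|n⁻⁴)·e^{4n}) 1`. -/
theorem decays_Oker : Decays (Oker n a) ((8 * (n : ℝ) ^ 2 + |a| / (n : ℝ) ^ 4) * Real.exp (4 * (n : ℝ))) 1 := by
  intro x z p q
  obtain rfl : p = () := Subsingleton.elim _ _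
  obtain rfl : q = () := Subsingleton.elim _ _
  by_cases h : Oker n a x z () () = 0
  · rw [h, abs_zero]; positivity
  · have hl := l1_le_of_Oker_ne_zero n a h
    calc |Oker n a x z () ()| ≤ 8 * (n : ℝ) ^ 2 + |a| / (n : ℝ) ^ 4 := abs_Oker_le n a x z
      _ ≤ (8 * (n : ℝ) ^ 2 + |a| / (n : ℝ) ^ 4) * (Real.exp (4 * (n : ℝ)) * Real.exp (-1 * l1 (x - z))) := by
          refine le_mul_of_one_le_right (by positivity) ?_
          rw [← Real.exp_add]; exact Real.one_le_exp (by linarith)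
      _ = _ := by ring

/-- [folklore] `Spr (Oker n a)`. -/
theorem spr_Oker : Spr (Oker n a) := ⟨_, 1, one_pos, decays_Oker n a⟩

/-- [folklore] **`Ggh ∘ O = 𝟙`** as kernels (`GhostLeg.tsum_Ggh_mul_AX`). -/
theorem comp_Ggh_Oker (ha : 0 < a) : comp (Ggh n a) (Oker n a) = idK := by
  funext x z p q; obtain rfl : p = () := Subsingleton.elim _ _; obtain rfl : q = () := Subsingleton.elim _ _
  rw [comp_unit_apply, idK_apply]; simp only [Oker_eq_AX, and_true]; exact tsum_Ggh_mul_AX n a ha x z () ()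

/-- [folklore] **`O ∘ Ggh = 𝟙`** as kernels (`GhostLeg.tsum_AX_mul_Ggh`). -/
theorem comp_Oker_Ggh (ha : 0 < a) : comp (Oker n a) (Ggh n a) = idK := by
  funext x z p q; obtain rfl : p = () := Subsingleton.elim _ _; obtain rfl : q = () := Subsingleton.elim _ _
  rw [comp_unit_apply, idK_apply]; simp only [Oker_eq_AX, and_true]; exact tsum_AX_mul_Ggh n a ha x z () ()

/-- [folklore] Right composition with the diagonal kernel `f̂ = (x z ↦ [x = z]·f x)` multiplies the column: `(K ∘ f̂)(x,z) = K x z · f z`. -/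
theorem comp_mulK_right (K : MKer 4 Unit) (f : Site 4 → ℝ) (x z : Site 4) (p q : Unit) :
    comp K (fun x z (_ _ : Unit) => if x = z then f x else 0) x z p q = K x z () () * f z := by
  rw [comp_unit_apply]
  have h : ∀ y : Site 4, K x y () () * (fun x z (_ _ : Unit) => if x = z then f x else 0) y z () ()
      = if y = z then K x z () () * f z else 0 := fun y => by
    by_cases hy : y = z
    · subst hy; simp
    · simp [hy]
  rw [tsum_congr h, tsum_ite_eq]

/-- [folklore] Left composition with the diagonal kernel multiplies the row: `(f̂ ∘ K)(x,z) = f x · K x z`. -/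
theorem comp_mulK_left (K : MKer 4 Unit) (f : Site 4 → ℝ) (x z : Site 4) (p q : Unit) :
    comp (fun x z (_ _ : Unit) => if x = z then f x else 0) K x z p q = f x * K x z () () := by
  rw [comp_unit_apply]
  have h : ∀ y : Site 4, (fun x z (_ _ : Unit) => if x = z then f x else 0) x y () () * K y z () ()
      = if y = x then f x * K x z () () else 0 := fun y => by
    by_cases hy : y = x
    · subst hy; simp
    · simp [Ne.symm hy, hy]
  rw [tsum_congr h, tsum_ite_eq]

/-- [folklore] **THE COMMUTATOR WITH `f̂` IS POINTWISE**: `K ∘ f̂ − f̂ ∘ K = (x z ↦ (f z − f x)·K x z)`. -/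
theorem comm_mulK_eq (K : MKer 4 Unit) (f : Site 4 → ℝ) :
    comp K (fun x z (_ _ : Unit) => if x = z then f x else 0) - comp (fun x z (_ _ : Unit) => if x = z then f x else 0) K
      = fun x z (_ _ : Unit) => (f z - f x) * K x z () () := by
  funext x z p q
  rw [Pi.sub_apply, Pi.sub_apply, Pi.sub_apply, Pi.sub_apply, comp_mulK_right, comp_mulK_left]
  ring

variable {n a}

/-- [folklore] The diagonal kernel of a BOUNDED function is spread (any rate; it is diagonal). -/
theorem spr_mulK {f : Site 4 → ℝ} {B : ℝ} (hf : ∀ x, |f x| ≤ B) : Spr (fun x z (_ _ : Unit) => if x = z then f x else 0) := by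
  refine ⟨B, 1, one_pos, fun x z p q => ?_⟩
  show |(if x = z then f x else 0)| ≤ _
  by_cases h : x = z
  · subst h; rw [if_pos rfl, sub_self, show l1 (0 : Site 4) = 0 by simp [l1], mul_zero, Real.exp_zero, mul_one]; exact hf x
  · rw [if_neg h, abs_zero]; have := (abs_nonneg _).trans (hf x); positivity

section Localised

variable {f : Site 4 → ℝ} {p : Site 4} {Cf δ : ℝ} (hδ : 0 < δ) (hf : ∀ x, |f x| ≤ Cf * Real.exp (-δ * l1 (x - p)))
include hδ hf

omit hδ in
/-- [folklore] The envelope constant is nonnegative. -/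
theorem env_const_nonneg : 0 ≤ Cf := by
  have h := hf p; rw [sub_self, show l1 (0 : Site 4) = 0 by simp [l1], mul_zero, Real.exp_zero, mul_one] at h
  exact (abs_nonneg _).trans h

/-- [folklore] A localised function is bounded by its envelope constant. -/
theorem abs_le_env_const (x : Site 4) : |f x| ≤ Cf :=
  (hf x).trans (by
    have : Real.exp (-δ * l1 (x - p)) ≤ 1 := Real.exp_le_one_iff.2 (by nlinarith [l1_nonneg (x - p)])
    nlinarith [env_const_nonneg hf])

omit hδ in
/-- [folklore] The diagonal kernel of a LOCALISED function (`|f x| ≤ Cf·e^{−δ|x − p|₁}`, `δ > 0`) is localised at `(p, p)`: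
`BiLoc f̂ p p Cf (δ/2)`. -/
theorem biLoc_mulK : BiLoc (fun x z (_ _ : Unit) => if x = z then f x else 0) p p Cf (δ / 2) := by
  intro x z u v
  have hC := env_const_nonneg hf
  show |(if x = z then f x else 0)| ≤ _
  by_cases h : x = z
  · subst h; rw [if_pos rfl]; refine (hf x).trans (le_of_eq ?_); congr 1; congr 1; ring
  · rw [if_neg h, abs_zero]; positivity

/-- [folklore] `Loc f̂` for a localised `f`. -/
theorem loc_mulK : Loc (fun x z (_ _ : Unit) => if x = z then f x else 0) := ⟨p, p, Cf, δ / 2, by linarith, biLoc_mulK hf⟩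

/-- [folklore] **THE COMMUTATOR OF A BOUNDED FINITE-RANGE KERNEL WITH A LOCALISED `f̂` IS LOCALISED**: if `|K x z| ≤ B` and `K x z ≠ 0 → |x − z|₁ ≤ R`
then `BiLoc (x z ↦ (f z − f x)·K x z) p p (2·B·Cf·e^{δR}) (δ/2)`. -/
theorem biLoc_commK_fr {K : MKer 4 Unit} {B R : ℝ} (hB : ∀ x z, |K x z () ()| ≤ B) (hR : ∀ x z, K x z () () ≠ 0 → l1 (x - z) ≤ R) (hR0 : 0 ≤ R) :
    BiLoc (fun x z (_ _ : Unit) => (f z - f x) * K x z () ()) p p (2 * B * Cf * Real.exp (δ * R)) (δ / 2) := by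
  have hC := env_const_nonneg hf
  have hB0 : 0 ≤ B := (abs_nonneg _).trans (hB p p)
  intro x z u v
  by_cases h0 : K x z () () = 0
  · simp only [h0, mul_zero, abs_zero]; positivity
  have hxz := hR x z h0
  have hzx : l1 (z - x) ≤ R := by rw [l1_sub_symm]; exact hxz
  have tx : l1 (z - p) ≤ l1 (z - x) + l1 (x - p) := l1_sub_triangle z x p
  have tz : l1 (x - p) ≤ l1 (x - z) + l1 (z - p) := l1_sub_triangle x z p
  have ex : Real.exp (-δ * l1 (x - p)) ≤ Real.exp (δ * R) * Real.exp (-(δ / 2) * (l1 (x - p) + l1 (z - p))) := by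
    rw [← Real.exp_add]; exact Real.exp_le_exp.2 (by nlinarith [l1_nonneg (x - p), l1_nonneg (z - p)])
  have ez : Real.exp (-δ * l1 (z - p)) ≤ Real.exp (δ * R) * Real.exp (-(δ / 2) * (l1 (x - p) + l1 (z - p))) := by
    rw [← Real.exp_add]; exact Real.exp_le_exp.2 (by nlinarith [l1_nonneg (x - p), l1_nonneg (z - p)])
  have hfx := (hf x).trans (mul_le_mul_of_nonneg_left ex hC)
  have hfz := (hf z).trans (mul_le_mul_of_nonneg_left ez hC)
  rw [abs_mul]
  calc |f z - f x| * |K x z () ()| ≤ (|f z| + |f x|) * B := mul_le_mul (abs_sub _ _) (hB x z) (abs_nonneg _) (by positivity)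
    _ ≤ (Cf * (Real.exp (δ * R) * Real.exp (-(δ / 2) * (l1 (x - p) + l1 (z - p))))
          + Cf * (Real.exp (δ * R) * Real.exp (-(δ / 2) * (l1 (x - p) + l1 (z - p))))) * B :=
        mul_le_mul_of_nonneg_right (add_le_add hfz hfx) hB0
    _ = 2 * B * Cf * Real.exp (δ * R) * Real.exp (-(δ / 2) * (l1 (x - p) + l1 (z - p))) := by ring

/-- [folklore] `Loc [O, f̂]` (the ghost operator has range `4n` and bounded entries). -/
theorem loc_commK_Oker : Loc (fun x z (_ _ : Unit) => (f z - f x) * Oker n a x z () ()) :=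
  ⟨p, p, _, δ / 2, by linarith, biLoc_commK_fr hδ hf (abs_Oker_le n a) (fun x z h => l1_le_of_Oker_ne_zero n a h) (by positivity)⟩

/-- [folklore] `Loc [P_a, f̂]`, `P_a x z = a·n⁻⁴·1[blk x = blk z]` (range `4n`, entries `≤ |a|n⁻⁴`). -/
theorem loc_commK_blk : Loc (fun x z (_ _ : Unit) => (f z - f x) * (a / (n : ℝ) ^ 4 * sameBlk (n - 1) x z)) := by
  have h := biLoc_commK_fr hδ hf (K := fun x z (_ _ : Unit) => a / (n : ℝ) ^ 4 * sameBlk (n - 1) x z) (B := |a| / (n : ℝ) ^ 4) (R := 4 * n)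
    (fun x z => by
      show |a / (n : ℝ) ^ 4 * sameBlk (n - 1) x z| ≤ _
      rw [abs_mul, abs_div, abs_of_nonneg (by positivity : (0:ℝ) ≤ (n : ℝ) ^ 4)]
      refine mul_le_of_le_one_right (by positivity) ?_
      unfold sameBlk; split_ifs <;> norm_num)
    (fun x z hne => by
      have hb : blk (n - 1) x = blk (n - 1) z := by
        by_contra hb
        exact hne (show a / (n : ℝ) ^ 4 * sameBlk (n - 1) x z = 0 by unfold sameBlk; rw [if_neg hb, mul_zero])
      exact l1_sub_le_of_blk_eq n hb)
    (by positivity)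
  exact ⟨p, p, _, δ / 2, by linarith, h⟩

omit [NeZero n] in
/-- [folklore] `Loc [n²(−Δ), f̂]` (the Laplacian has range `1` and entries `≤ 8`). -/
theorem loc_commK_lap : Loc (fun x z (_ _ : Unit) => (f z - f x) * ((n : ℝ) ^ 2 * lapKer (d := 4) x z)) := by
  have h := biLoc_commK_fr hδ hf (K := fun x z (_ _ : Unit) => (n : ℝ) ^ 2 * lapKer (d := 4) x z) (B := (n : ℝ) ^ 2 * 8) (R := 1)
    (fun x z => by
      show |(n : ℝ) ^ 2 * lapKer (d := 4) x z| ≤ _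
      rw [abs_mul, abs_of_nonneg (by positivity : (0:ℝ) ≤ (n : ℝ) ^ 2)]
      exact mul_le_mul_of_nonneg_left (abs_lapKer_le_eight x z) (by positivity))
    (fun x z hne => l1_le_one_of_lapKer_ne_zero (fun h0 => hne (show (n : ℝ) ^ 2 * lapKer (d := 4) x z = 0 by rw [h0, mul_zero])))
    zero_le_one
  exact ⟨p, p, _, δ / 2, by linarith, h⟩

end Localised

/-- [folklore] **BUBBLE SYMMETRY**: `bubble A V W = bubble A W V` (trace cyclicity, one localised and one tame factor). -/
theorem bubble_symm {A V W : MKer 4 Unit} (hA : Spr A) (hV : Loc V) (hW : Loc W) : bubble A V W = bubble A W V := by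
  unfold ExpKernelCalculus.bubble
  exact tr_comp_comm_loc (hA.comp_loc hV) (hA.comp_loc hW).tame

/-- [folklore] Subtractivity of the bubble in the second vertex (from an2's `bubble_add_right`). -/
theorem bubble_sub_right {A Y Z₁ Z₂ : MKer 4 Unit} (hA : Spr A) (hY : Loc Y) (h₁ : Loc Z₁) (h₂ : Loc Z₂) :
    bubble A Y (Z₁ - Z₂) = bubble A Y Z₁ - bubble A Y Z₂ := by
  have h := bubble_add_right hA hY (h₁.sub h₂) h₂
  rw [sub_add_cancel] at h
  linarith

/-- [folklore] Subtractivity of the bubble in the first vertex. -/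
theorem bubble_sub_left {A V₁ V₂ Z : MKer 4 Unit} (hA : Spr A) (h₁ : Loc V₁) (h₂ : Loc V₂) (hZ : Loc Z) :
    bubble A (V₁ - V₂) Z = bubble A V₁ Z - bubble A V₂ Z := by
  have h := bubble_add_left hA (h₁.sub h₂) h₂ hZ
  rw [sub_add_cancel] at h
  linarith

/-! ## §2 The telescoping lemma Ω: `bubble Ggh V [O, f̂] = tadpole Ggh [V, f̂]` -/

section Omega

variable (n a)
variable {f : Site 4 → ℝ} {p : Site 4} {Cf δ : ℝ}

/-- [folklore] **Ω — THE FROZEN-AVERAGING WARD TELESCOPE**: for the ghost leg `Ggh n a` (`0 < a`), ANY localised vertex `V` and any localised gauge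
function `f`, `bubble (Ggh n a) V [O, f̂] = tadpole (Ggh n a) [V, f̂]` — `tr((GV)(G[O,f̂])) = tr((GV)f̂) − tr((GV)(Gf̂)O) = tr((GV)f̂) − tr((Gf̂)V)
= tr(G[V,f̂])` by `G∘O = 𝟙 = O∘G` and cyclicity (`KernelWard.ward_hess`'s step 2 with `f̂` for `genX u`). -/
theorem bubble_Ggh_comm_Oker (ha : 0 < a) (hδ : 0 < δ) (hf : ∀ x, |f x| ≤ Cf * Real.exp (-δ * l1 (x - p))) {V : MKer 4 Unit} (hV : Loc V) :
    bubble (Ggh n a) V (fun x z (_ _ : Unit) => (f z - f x) * Oker n a x z () ())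
      = tadpole (Ggh n a) (fun x z (_ _ : Unit) => (f z - f x) * V x z () ()) := by
  -- names and letters
  set G : MKer 4 Unit := Ggh n a with hG
  set O : MKer 4 Unit := Oker n a with hO
  set F : MKer 4 Unit := fun x z (_ _ : Unit) => if x = z then f x else 0 with hF
  have hGs : Spr G := spr_Ggh n a ha
  have hOs : Spr O := spr_Oker n a
  have hFs : Spr F := spr_mulK (abs_le_env_const hδ hf)
  have hFl : Loc F := loc_mulK hδ hf
  have hGt := hGs.tame
  have hOt := hOs.tame
  have hFt := hFs.tame
  have hVt := hV.tame
  have hOF : Loc (comp O F) := hOs.comp_loc hFl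
  have hFO : Loc (comp F O) := hFl.comp_spr hOs
  have hGF : Loc (comp G F) := hGs.comp_loc hFl
  have hGV : Loc (comp G V) := hGs.comp_loc hV
  have hVF : Loc (comp V F) := hV.comp hFl
  have hFV : Loc (comp F V) := hFl.comp hV
  -- the two commutators as differences of compositions
  have eO : (fun x z (_ _ : Unit) => (f z - f x) * Oker n a x z () ()) = comp O F - comp F O := (comm_mulK_eq O f).symm
  have eV : (fun x z (_ _ : Unit) => (f z - f x) * V x z () ()) = comp V F - comp F V := (comm_mulK_eq V f).symm
  rw [eO, eV]
  -- `G ∘ [O, F] = F − (G F) O`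
  have e1 : comp G (comp O F - comp F O) = F - comp (comp G F) O := by
    rw [comp_sub_right_tame hGt hOF.tame hFO.tame, comp_assoc_tame hGt hOt hFt, comp_assoc_tame hGt hFt hOt, hG, hO,
      comp_Ggh_Oker n a ha, comp_idK_left]
  -- `tr((GV)((GF)O)) = tr((GF)V)`
  have e2 : tr (comp (comp G V) (comp (comp G F) O)) = tr (comp (comp G F) V) := by
    rw [comp_assoc_tame hGV.tame hGF.tame hOt, tr_comp_comm_loc (hGV.comp hGF) hOt, comp_assoc_tame hOt hGV.tame hGF.tame,
      comp_assoc_tame hOt hGt hVt, hO, hG, comp_Oker_Ggh n a ha, comp_idK_left, tr_comp_comm_loc hV hGF.tame]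
  -- assemble
  unfold ExpKernelCalculus.bubble ExpKernelCalculus.tadpole
  rw [e1, comp_sub_right_tame hGV.tame hFt (hGF.comp_spr hOs).tame, tr_sub_loc (hGV.comp hFl) (hGV.comp (hGF.comp_spr hOs)), e2,
    comp_sub_right_tame hGt hVF.tame hFV.tame, tr_sub_loc (hGs.comp_loc hVF) (hGs.comp_loc hFV), comp_assoc_tame hGt hVt hFt,
    comp_assoc_tame hGt hFt hVt]

end Omega

/-! ## §3 The gauge slots of the `D*D`-only Hessian see only the frozen averaging `P_a` -/

section Slots

variable (n a)
variable {f f' : Site 4 → ℝ} {p p' : Site 4} {Cf Cf' δ δ' : ℝ}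

/-- [folklore] **ONE GAUGE SLOT**: for `Loc V` and a localised `f`,
`½·tadpole Ggh [V, f̂] − ½·bubble Ggh V [n²(−Δ), f̂] = ½·bubble Ggh V [P_a, f̂]` (`[n²(−Δ), f̂] = [O, f̂] − [P_a, f̂]`, `Oker_apply`; Ω). -/
theorem hess_slot_grad (ha : 0 < a) (hδ : 0 < δ) (hf : ∀ x, |f x| ≤ Cf * Real.exp (-δ * l1 (x - p))) {V : MKer 4 Unit} (hV : Loc V) :
    (1 / 2) * tadpole (Ggh n a) (fun x z (_ _ : Unit) => (f z - f x) * V x z () ())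
        - (1 / 2) * bubble (Ggh n a) V (fun x z (_ _ : Unit) => (f z - f x) * ((n : ℝ) ^ 2 * lapKer (d := 4) x z))
      = (1 / 2) * bubble (Ggh n a) V (fun x z (_ _ : Unit) => (f z - f x) * (a / (n : ℝ) ^ 4 * sameBlk (n - 1) x z)) := by
  have hsplit : (fun x z (_ _ : Unit) => (f z - f x) * ((n : ℝ) ^ 2 * lapKer (d := 4) x z))
      = (fun x z (_ _ : Unit) => (f z - f x) * Oker n a x z () ()) - (fun x z (_ _ : Unit) => (f z - f x) * (a / (n : ℝ) ^ 4 * sameBlk (n - 1) x z)) := by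
    funext x z u v
    simp only [Pi.sub_apply, Oker_apply]
    ring
  rw [hsplit, bubble_sub_right (spr_Ggh n a ha) hV (loc_commK_Oker hδ hf) (loc_commK_blk hδ hf), bubble_Ggh_comm_Oker n a ha hδ hf hV]
  ring

/-- [folklore] **THE MIRROR SLOT**: `½·tadpole Ggh [V, f̂] − ½·bubble Ggh [n²(−Δ), f̂] V = ½·bubble Ggh [P_a, f̂] V` (bubble symmetry). -/
theorem hess_grad_slot (ha : 0 < a) (hδ : 0 < δ) (hf : ∀ x, |f x| ≤ Cf * Real.exp (-δ * l1 (x - p))) {V : MKer 4 Unit} (hV : Loc V) :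
    (1 / 2) * tadpole (Ggh n a) (fun x z (_ _ : Unit) => (f z - f x) * V x z () ())
        - (1 / 2) * bubble (Ggh n a) (fun x z (_ _ : Unit) => (f z - f x) * ((n : ℝ) ^ 2 * lapKer (d := 4) x z)) V
      = (1 / 2) * bubble (Ggh n a) (fun x z (_ _ : Unit) => (f z - f x) * (a / (n : ℝ) ^ 4 * sameBlk (n - 1) x z)) V := by
  rw [bubble_symm (spr_Ggh n a ha) (loc_commK_lap hδ hf) hV, bubble_symm (spr_Ggh n a ha) (loc_commK_blk hδ hf) hV]
  exact hess_slot_grad n a ha hδ hf hV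

/-- [folklore] **BOTH GAUGE SLOTS**: `½·tadpole Ggh [[n²(−Δ), f̂], f̂′] − ½·bubble Ggh [n²(−Δ), f̂] [n²(−Δ), f̂′]
= ½·tadpole Ggh [[P_a, f̂′], f̂] − ½·bubble Ggh [P_a, f̂] [P_a, f̂′]` (`hess_slot_grad` at `V := [n²(−Δ), f̂]`, then Ω at `V := [P_a, f̂′]`). -/
theorem hess_grad_grad (ha : 0 < a) (hδ : 0 < δ) (hf : ∀ x, |f x| ≤ Cf * Real.exp (-δ * l1 (x - p)))
    (hδ' : 0 < δ') (hf' : ∀ x, |f' x| ≤ Cf' * Real.exp (-δ' * l1 (x - p'))) :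
    (1 / 2) * tadpole (Ggh n a) (fun x z (_ _ : Unit) => (f' z - f' x) * ((f z - f x) * ((n : ℝ) ^ 2 * lapKer (d := 4) x z)))
        - (1 / 2) * bubble (Ggh n a) (fun x z (_ _ : Unit) => (f z - f x) * ((n : ℝ) ^ 2 * lapKer (d := 4) x z))
            (fun x z (_ _ : Unit) => (f' z - f' x) * ((n : ℝ) ^ 2 * lapKer (d := 4) x z))
      = (1 / 2) * tadpole (Ggh n a) (fun x z (_ _ : Unit) => (f z - f x) * ((f' z - f' x) * (a / (n : ℝ) ^ 4 * sameBlk (n - 1) x z)))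
        - (1 / 2) * bubble (Ggh n a) (fun x z (_ _ : Unit) => (f z - f x) * (a / (n : ℝ) ^ 4 * sameBlk (n - 1) x z))
            (fun x z (_ _ : Unit) => (f' z - f' x) * (a / (n : ℝ) ^ 4 * sameBlk (n - 1) x z)) := by
  have hG := spr_Ggh n a ha
  have hL : Loc (fun x z (_ _ : Unit) => (f z - f x) * ((n : ℝ) ^ 2 * lapKer (d := 4) x z)) := loc_commK_lap hδ hf
  have hB : Loc (fun x z (_ _ : Unit) => (f z - f x) * (a / (n : ℝ) ^ 4 * sameBlk (n - 1) x z)) := loc_commK_blk hδ hf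
  have hB' : Loc (fun x z (_ _ : Unit) => (f' z - f' x) * (a / (n : ℝ) ^ 4 * sameBlk (n - 1) x z)) := loc_commK_blk hδ' hf'
  have hO' : Loc (fun x z (_ _ : Unit) => (f' z - f' x) * Oker n a x z () ()) := loc_commK_Oker hδ' hf'
  -- step 1: the first gauge slot against the localised vertex `[n²(−Δ), f̂]`
  have h1 := hess_slot_grad n a ha hδ' hf' hL
  rw [h1]
  -- step 2: split the vertex `[n²(−Δ), f̂] = [O, f̂] − [P_a, f̂]` in the FIRST slot, and telescope the `[O, f̂]` part by Ω (after a symmetry)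
  have hsplit : (fun x z (_ _ : Unit) => (f z - f x) * ((n : ℝ) ^ 2 * lapKer (d := 4) x z))
      = (fun x z (_ _ : Unit) => (f z - f x) * Oker n a x z () ()) - (fun x z (_ _ : Unit) => (f z - f x) * (a / (n : ℝ) ^ 4 * sameBlk (n - 1) x z)) := by
    funext x z u v
    simp only [Pi.sub_apply, Oker_apply]
    ring
  rw [hsplit, bubble_sub_left hG (loc_commK_Oker hδ hf) hB hB', bubble_symm hG (loc_commK_Oker hδ hf) hB',
    bubble_Ggh_comm_Oker n a ha hδ hf hB']
  ring

end Slots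

end Summit.QuantumFields.BalabanUV.Beta.D1BFx.FrozenAveragingWard

end
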